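import Mathlib
import HarnessLib

/-!
# ζ(5) search — Families: the REGIME constant-term functional on gap polynomials (`g₀ ≫ g₁ ≫ ⋯ ≫ g_M`)

HONEST FRAMING: systematic search; no irrationality claim unless certified.  Cell `pub-zeta5`, seat P2 g10 (Families
layer), 2026-08-23.  Finite identities between integers (generalised binomial coefficients) and integer polynomials;
nothing about the arithmetic of any zeta value; no record moves; no conjecture node is used.

PURPOSE.  The tool behind the GAUGE INVARIANCE of dual gap constant terms (`Families/GapGaugeMove`,
`Families/VIMGaugeInvariance`): a `ℤ`-linear functional on `ℤ[g₀,…,g_M]` that extends coefficient extraction to the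
formal quotients `P / ∏_i T_i^{c_i}` by the SUFFIX SUMS `T_i = g_i + g_{i+1} + ⋯ + g_M`, computed in the regime
`g₀ ≫ g₁ ≫ ⋯ ≫ g_M` (there `T_i = g_i (1 + T_{i+1}/g_i)` and `(1 + T_{i+1}/g_i)^{−c}` is a binomial series).  Everything is
FINITE: no series ring is built; the functional is an explicit peeling recursion on exponent data and its two structural
properties are proved by induction on the number of gaps.

* `GapRegime.E M a c` (`a c : Fin (M+1) → ℤ`): the regime constant term of `g^a · ∏_i T_i^{−c_i}` — peel the largest gap
  `g₀`: `g₀^{a₀} T₀^{−c₀} = Σ_j C(−c₀, j) T₁^{j} g₀^{a₀−c₀−j}`, keep `j = a₀ − c₀ ≥ 0`, push `T₁^{j}` into `c₁`, recurse;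
  one gap: `[a₀ = c₀]`.  (`C(x, j) = Ring.choose x j`, the generalised binomial coefficient on `ℤ`.)
* `GapRegime.E_zero`      : `E a 0 = [a = 0]` (no denominators: the honest constant term).
* `GapRegime.E_key`       : `Σ_{j ≥ i} E (a + δ_j) c = E a (c − δ_i)` — multiplying by `T_i = Σ_{j ≥ i} g_j` cancels one
  power of `T_i` in the denominator (Pascal's rule for `Ring.choose`).
* `GapRegime.E_star`      : the exponent data of the image of a monomial `h^k` of the NEIGHBOURING gauge
  (`h₀ = 1/T₀`, `h_{t+1} = g_t/(T_t T_{t+1})`, see `Families/GapGaugeMove`) has regime constant term `[k = 0]`.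
* DEFINITIONS for the sequel files (theory there): the suffix sums `T`, the offset shift `shift`, the additive
  functional `Phi c L P = Σ_d [g^d]P · E (d − L) c` (`Families/GapRegimePhi`), the chord spans `spanPoly`, the span
  product `endProd` of a gauge, the gap monomial `gapVec` and the down-shift `aVec` (`Families/GapGaugeMove`).
What this is NOT: no statement about cellular integrals is made here (that is `Families/GapGaugeMove`).  Standard axioms only.
-/

namespace Summit.KontsevichZagierPeriods.Zeta5Search.Families.Cellular

namespace GapRegime

open MvPolynomial Finset

/-! ## The peeling recursion `E` -/

/-- **Regime constant term on exponent data.**  `E M a c` = the constant term, in the regime `g₀ ≫ g₁ ≫ ⋯ ≫ g_M`, of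
`g^a · ∏_{i ≤ M} T_i^{−c_i}` with `T_i = g_i + ⋯ + g_M`: peel `g₀` (keep the binomial-series index `j = a₀ − c₀`, weight
`C(−c₀, j)`, push `T₁^{j}` into the next denominator exponent), recurse; for one gap `T₀ = g₀` and the value is `[a₀ = c₀]`. -/
def E : (M : ℕ) → (Fin (M + 1) → ℤ) → (Fin (M + 1) → ℤ) → ℤ
  | 0, a, c => if a 0 = c 0 then 1 else 0
  | M + 1, a, c =>
      if c 0 ≤ a 0 then
        Ring.choose (-(c 0)) (a 0 - c 0).toNat *
          E M (Fin.tail a) (Function.update (Fin.tail c) 0 (c 1 - (a 0 - c 0)))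
      else 0

/-- Unfolding `E` for one gap. -/
theorem E_zero_gap (a c : Fin 1 → ℤ) : E 0 a c = if a 0 = c 0 then 1 else 0 := rfl

/-- Unfolding `E` for `M + 2` gaps. -/
theorem E_succ (M : ℕ) (a c : Fin (M + 2) → ℤ) :
    E (M + 1) a c = if c 0 ≤ a 0 then
        Ring.choose (-(c 0)) (a 0 - c 0).toNat *
          E M (Fin.tail a) (Function.update (Fin.tail c) 0 (c 1 - (a 0 - c 0)))
      else 0 := rfl

/-- The unit vector `δ_j` on `Fin (M+1) → ℤ`. -/
abbrev δ {M : ℕ} (j : Fin (M + 1)) : Fin (M + 1) → ℤ := Pi.single j 1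

/-- `Fin.tail (δ_{j+1}) = δ_j`. -/
theorem tail_delta_succ {M : ℕ} (j : Fin (M + 1)) :
    Fin.tail (Pi.single (M := fun _ : Fin (M + 2) => ℤ) j.succ (1 : ℤ)) = Pi.single j 1 := by
  ext i
  simp [Fin.tail, Pi.single_apply, Fin.succ_inj]

/-- `Fin.tail (δ₀) = 0`. -/
theorem tail_delta_zero {M : ℕ} :
    Fin.tail (Pi.single (M := fun _ : Fin (M + 2) => ℤ) 0 (1 : ℤ)) = 0 := by
  ext i
  simp [Fin.tail, Fin.succ_ne_zero]

/-- **No denominators: `E a 0` is the honest constant term `[a = 0]`.** -/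
theorem E_zero : ∀ (M : ℕ) (a : Fin (M + 1) → ℤ), E M a 0 = if a = 0 then 1 else 0 := by
  intro M
  induction M with
  | zero =>
    intro a
    rw [E_zero_gap]
    by_cases h : a = 0
    · simp [h]
    · have h0 : a 0 ≠ 0 := by
        intro h0; apply h; ext i; rw [Fin.fin_one_eq_zero i, h0]; rfl
      simp [h, h0]
  | succ M ih =>
    intro a
    rw [E_succ]
    simp only [Pi.zero_apply, neg_zero, sub_zero, Fin.tail_def]
    by_cases ha0 : 0 ≤ a 0
    · rw [if_pos ha0, Ring.choose_zero_ite]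
      by_cases ha0' : a 0 = 0
      · have hupd : Function.update (Fin.tail (0 : Fin (M + 2) → ℤ)) 0 (0 - a 0) = 0 := by
          ext i; by_cases hi : i = 0
          · subst hi; simp [ha0']
          · rw [Function.update_of_ne hi]; rfl
        have htoNat : (a 0).toNat = 0 := by rw [ha0']; rfl
        rw [htoNat, if_pos rfl, one_mul]
        change E M (Fin.tail a) (Function.update (Fin.tail (0 : Fin (M + 2) → ℤ)) 0 (0 - a 0)) = _
        rw [hupd, ih (Fin.tail a)]
        have hiff : Fin.tail a = 0 ↔ a = 0 := by
          constructor
          · intro ht; ext i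
            refine Fin.cases ?_ (fun j => ?_) i
            · exact ha0'
            · have := congrFun ht j; simpa [Fin.tail] using this
          · intro h; subst h; rfl
        simp only [hiff]
      · have htoNat : (a 0).toNat ≠ 0 := by
          intro ht; apply ha0'; have := Int.toNat_eq_zero.1 ht; omega
        rw [if_neg htoNat, zero_mul]
        have h : a ≠ 0 := fun h => ha0' (by rw [h]; rfl)
        rw [if_neg h]
    · rw [if_neg ha0]
      have h : a ≠ 0 := fun h => ha0 (by rw [h]; exact le_refl _)
      rw [if_neg h]

/-- Pascal's rule for `Ring.choose` on `ℤ` in the `toNat`-indexed form used by the peeling step: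
for `c ≤ a + 1`, `C(1 − c, a + 1 − c) = C(−c, a + 1 − c) + [c ≤ a] · C(−c, a − c)`. -/
theorem choose_step (a c : ℤ) (h : c ≤ a + 1) :
    Ring.choose (-(c - 1)) (a - (c - 1)).toNat =
      Ring.choose (-c) (a + 1 - c).toNat + (if c ≤ a then Ring.choose (-c) (a - c).toNat else 0) := by
  by_cases hca : c ≤ a
  · rw [if_pos hca]
    have e1 : (a - (c - 1)).toNat = (a - c).toNat + 1 := by omega
    have e2 : (a + 1 - c).toNat = (a - c).toNat + 1 := by omega
    rw [e1, e2, show -(c - 1) = -c + 1 by ring, Ring.choose_succ_succ, add_comm]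
  · rw [if_neg hca, add_zero]
    have hc : c = a + 1 := le_antisymm h (by omega)
    subst hc
    have e1 : (a - (a + 1 - 1)).toNat = 0 := by simp
    have e2 : (a + 1 - (a + 1)).toNat = 0 := by simp
    rw [e1, e2, Ring.choose_zero_right, Ring.choose_zero_right]

/-- **KEY LEMMA.**  Multiplying by the suffix sum `T_i = Σ_{j ≥ i} g_j` cancels one power of `T_i` in the denominator:
`Σ_{j ≥ i} E (a + δ_j) c = E a (c − δ_i)`. -/
theorem E_key : ∀ (M : ℕ) (a c : Fin (M + 1) → ℤ) (i : Fin (M + 1)),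
    (∑ j : Fin (M + 1), if i ≤ j then E M (a + δ j) c else 0) = E M a (c - δ i) := by
  intro M
  induction M with
  | zero =>
    intro a c i
    have hi : i = 0 := Fin.fin_one_eq_zero i
    subst hi
    rw [Fin.sum_univ_one, if_pos (le_refl _), E_zero_gap, E_zero_gap]
    simp only [Pi.add_apply, Pi.single_eq_same, Pi.sub_apply]
    by_cases h : a 0 + 1 = c 0
    · rw [if_pos h, if_pos (by omega)]
    · rw [if_neg h, if_neg (by omega)]
  | succ M ih =>
    intro a c i
    rw [Fin.sum_univ_succ]
    -- the tail terms `j = j'.succ`: the head data `(a 0, c 0)` is untouched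
    have htail : ∀ j' : Fin (M + 1),
        E (M + 1) (a + δ j'.succ) c =
          if c 0 ≤ a 0 then Ring.choose (-(c 0)) (a 0 - c 0).toNat *
            E M (Fin.tail a + δ j') (Function.update (Fin.tail c) 0 (c 1 - (a 0 - c 0))) else 0 := by
      intro j'
      rw [E_succ]
      have h0 : (a + δ j'.succ) 0 = a 0 := by simp [Fin.succ_ne_zero]
      have ht : Fin.tail (a + δ j'.succ) = Fin.tail a + δ j' := by
        rw [show Fin.tail (a + δ j'.succ) = Fin.tail a + Fin.tail (δ j'.succ) from rfl, tail_delta_succ]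
      rw [h0, ht]
    refine Fin.cases ?_ (fun i' => ?_) i
    · -- i = 0 : every j counts
      simp only [le_refl, if_true, Fin.zero_le]
      have hhead : E (M + 1) (a + δ 0) c =
          if c 0 ≤ a 0 + 1 then Ring.choose (-(c 0)) (a 0 + 1 - c 0).toNat *
            E M (Fin.tail a) (Function.update (Fin.tail c) 0 (c 1 - (a 0 + 1 - c 0))) else 0 := by
        rw [E_succ]
        have h0 : (a + δ (0 : Fin (M + 2))) 0 = a 0 + 1 := by simp
        have ht : Fin.tail (a + δ (0 : Fin (M + 2))) = Fin.tail a := by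
          rw [show Fin.tail (a + δ (0 : Fin (M + 2))) = Fin.tail a + Fin.tail (δ 0) from rfl, tail_delta_zero,
            add_zero]
        rw [h0, ht]
      rw [hhead]
      simp only [htail]
      -- the sum over j' of the tail terms, by the induction hypothesis at i = 0
      have hsum : (∑ j' : Fin (M + 1), if c 0 ≤ a 0 then Ring.choose (-(c 0)) (a 0 - c 0).toNat *
            E M (Fin.tail a + δ j') (Function.update (Fin.tail c) 0 (c 1 - (a 0 - c 0))) else 0) =
          if c 0 ≤ a 0 then Ring.choose (-(c 0)) (a 0 - c 0).toNat *
            E M (Fin.tail a) (Function.update (Fin.tail c) 0 (c 1 - (a 0 - c 0)) - δ 0) else 0 := by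
        by_cases h : c 0 ≤ a 0
        · simp only [if_pos h, ← Finset.mul_sum]
          congr 1
          have := ih (Fin.tail a) (Function.update (Fin.tail c) 0 (c 1 - (a 0 - c 0))) 0
          simpa using this
        · simp [if_neg h]
      rw [hsum]
      -- the right-hand side
      rw [E_succ]
      have hc0 : (c - δ (0 : Fin (M + 2))) 0 = c 0 - 1 := by simp
      have hc1 : (c - δ (0 : Fin (M + 2))) 1 = c 1 := by simp
      have hct : Fin.tail (c - δ (0 : Fin (M + 2))) = Fin.tail c := by
        rw [show Fin.tail (c - δ (0 : Fin (M + 2))) = Fin.tail c - Fin.tail (δ 0) from rfl, tail_delta_zero, sub_zero]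
      rw [hc0, hc1, hct]
      have hupd : Function.update (Fin.tail c) 0 (c 1 - (a 0 - c 0)) - δ (0 : Fin (M + 1)) =
          Function.update (Fin.tail c) 0 (c 1 - (a 0 + 1 - c 0)) := by
        ext k; by_cases hk : k = 0
        · subst hk; simp; ring
        · simp [hk]
      rw [hupd]
      have e3 : c 1 - (a 0 - (c 0 - 1)) = c 1 - (a 0 + 1 - c 0) := by ring
      rw [e3]
      by_cases h : c 0 ≤ a 0 + 1
      · rw [if_pos h, if_pos (show c 0 - 1 ≤ a 0 by omega), choose_step _ _ h]
        by_cases h' : c 0 ≤ a 0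
        · simp only [if_pos h']; ring
        · simp only [if_neg h']; ring
      · rw [if_neg h, if_neg (show ¬ (c 0 - 1 ≤ a 0) by omega), if_neg (show ¬ (c 0 ≤ a 0) by omega)]; simp
    · -- i = i'.succ : only the tail terms `j = j'.succ` with `i' ≤ j'` count
      have hne : ¬ (i'.succ ≤ (0 : Fin (M + 2))) := by simp [Fin.succ_ne_zero]
      rw [if_neg hne, zero_add]
      simp only [Fin.succ_le_succ_iff, htail]
      rw [E_succ]
      have hc0 : (c - δ i'.succ) 0 = c 0 := by simp [Fin.succ_ne_zero]
      have hct : Fin.tail (c - δ i'.succ) = Fin.tail c - δ i' := by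
        rw [show Fin.tail (c - δ i'.succ) = Fin.tail c - Fin.tail (δ i'.succ) from rfl, tail_delta_succ]
      rw [hc0, hct]
      by_cases h : c 0 ≤ a 0
      · simp only [if_pos h]
        have hpull : ∀ x : Fin (M + 1), (if i' ≤ x then Ring.choose (-(c 0)) (a 0 - c 0).toNat *
            E M (Fin.tail a + δ x) (Function.update (Fin.tail c) 0 (c 1 - (a 0 - c 0))) else (0 : ℤ)) =
            Ring.choose (-(c 0)) (a 0 - c 0).toNat * (if i' ≤ x then
              E M (Fin.tail a + δ x) (Function.update (Fin.tail c) 0 (c 1 - (a 0 - c 0))) else 0) := by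
          intro x; split_ifs <;> simp
        simp only [hpull, ← Finset.mul_sum]
        rw [ih (Fin.tail a) _ i']
        congr 2
        ext k; by_cases hk : k = 0
        · subst hk
          by_cases hi0 : i' = 0
          · subst hi0; simp; ring
          · have h1 : (1 : Fin (M + 2)) ≠ i'.succ := by
              rw [show (1 : Fin (M + 2)) = Fin.succ 0 from rfl]
              exact fun h => hi0 (Fin.succ_inj.1 h).symm
            simp [Ne.symm hi0, h1]
        · simp [Function.update_of_ne hk, Pi.single_apply]
      · simp [if_neg h]

/-! ## The shape lemma `(★)` for the images of the gauge-move monomials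

In `Families/GapGaugeMove` the neighbouring gauge has gaps `h₀ = 1/T₀`, `h_{t+1} = g_t/(T_t T_{t+1})` (`t < M`), so the
monomial `h^k` (`k : Fin (M+1) → ℤ`) maps to `g^a ∏ T^{−c}` with `a = (k₁, …, k_M, 0)` and `c = k + a`.  We prove the
slightly more general statement with the last entry of `a` arbitrary. -/

/-- `(★)`: **the regime constant term of the image of `h^k` is `[k = 0]`**: if `a_t = k_{t+1}` for `t < M` then
`E a (k + a) = [k = 0]`. -/
theorem E_star : ∀ (M : ℕ) (k a : Fin (M + 1) → ℤ), (∀ t : Fin M, a t.castSucc = k t.succ) →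
    E M a (k + a) = if k = 0 then 1 else 0 := by
  intro M
  induction M with
  | zero =>
    intro k a _
    rw [E_zero_gap]
    simp only [Pi.add_apply]
    by_cases h : k = 0
    · subst h; simp
    · have h0 : k 0 ≠ 0 := by
        intro h0; apply h; ext i; rw [Fin.fin_one_eq_zero i, h0]; rfl
      rw [if_neg h, if_neg (by omega)]
  | succ M ih =>
    intro k a hak
    rw [E_succ]
    have ha0 : a 0 = k 1 := by
      have := hak 0; simpa using this
    simp only [Pi.add_apply]
    -- the merged vector k'' = (k₀ + k₁, k₂, …, k_{M+1})
    set k'' : Fin (M + 1) → ℤ := Function.update (Fin.tail k) 0 (k 0 + k 1) with hk''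
    have htail : Function.update (Fin.tail (k + a)) 0 (k 1 + a 1 - (a 0 - (k 0 + a 0))) = k'' + Fin.tail a := by
      ext t
      by_cases ht : t = 0
      · subst ht
        rw [Function.update_self, Pi.add_apply, hk'', Function.update_self]
        show k 1 + a 1 - (a 0 - (k 0 + a 0)) = k 0 + k 1 + a (Fin.succ 0)
        rw [show (Fin.succ 0 : Fin (M + 2)) = 1 from rfl]; ring
      · rw [Function.update_of_ne ht, Pi.add_apply, hk'', Function.update_of_ne ht]; rfl
    have hak'' : ∀ t : Fin M, Fin.tail a t.castSucc = k'' t.succ := by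
      intro t
      rw [hk'', Function.update_of_ne (Fin.succ_ne_zero t)]
      show a t.castSucc.succ = k t.succ.succ
      have e : t.castSucc.succ = t.succ.castSucc := Fin.ext (by simp)
      rw [e]; exact hak t.succ
    have hrec := ih k'' (Fin.tail a) hak''
    rw [show k (1 : Fin (M + 2)) + a 1 = k 1 + a 1 from rfl] at *
    rw [htail, hrec]
    by_cases h'' : k'' = 0
    · -- then k₀ + k₁ = 0 and k_t = 0 for t ≥ 2
      rw [if_pos h'', mul_one]
      have h01 : k 0 + k 1 = 0 := by
        have := congrFun h'' 0; rw [hk'', Function.update_self] at this; exact this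
      have hge2 : ∀ j : Fin (M + 1), j ≠ 0 → k j.succ = 0 := by
        intro j hj
        have := congrFun h'' j
        rw [hk'', Function.update_of_ne hj] at this
        exact this
      rw [show a 0 - (k 0 + a 0) = -(k 0) by ring, show -(k 0 + a 0) = -(k 0 + k 1) by rw [ha0], h01, neg_zero,
        Ring.choose_zero_ite]
      by_cases hk00 : k 0 = 0
      · have hk : k = 0 := by
          ext i
          refine Fin.cases ?_ (fun j => ?_) i
          · exact hk00
          · by_cases hj : j = 0
            · subst hj; show k 1 = 0; omega
            · exact hge2 j hj
        rw [if_pos hk, hk00, if_pos (by omega), neg_zero, Int.toNat_zero, if_pos rfl]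
      · have hk : k ≠ 0 := fun h => hk00 (by rw [h]; rfl)
        rw [if_neg hk]
        by_cases hk0 : k 0 ≤ 0
        · rw [if_pos (by omega), if_neg (by omega)]
        · rw [if_neg (by omega)]
    · rw [if_neg h'', mul_zero]
      have hk : k ≠ 0 := by
        intro h; apply h''; rw [hk'', h]; ext t
        by_cases ht : t = 0
        · subst ht; simp
        · rw [Function.update_of_ne ht]; rfl
      rw [if_neg hk]
      split_ifs <;> rfl

/-! ## Definitions used by the gauge-move files (`Families/GapRegimePhi`, `Families/GapGaugeMove`)

Only the definitions live here (so that one reviewed file carries them); their theory is in the sequel files. -/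

section Defs

variable {M : ℕ}

/-- The suffix sum `T_i = g_i + g_{i+1} + ⋯ + g_M` (position of the `i`-th finite point above the anchor). -/
noncomputable def T (M : ℕ) (i : Fin (M + 1)) : MvPolynomial (Fin (M + 1)) ℤ :=
  ∑ j : Fin (M + 1), if i ≤ j then X j else 0

/-- The integer exponent vector of a monomial `d` shifted by the offset `L`: `(d − L)_i = d_i − L_i`. -/
def shift (d : Fin (M + 1) →₀ ℕ) (L : Fin (M + 1) → ℕ) : Fin (M + 1) → ℤ := fun i => (d i : ℤ) - L i

/-- **The regime functional with denominator exponents `c` and offset `L`:**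
`Phi c L P = Σ_d [g^d]P · E (d − L) c` — the regime constant term of `P · g^{−L} · ∏_i T_i^{−c_i}`; additive in `P`. -/
noncomputable def Phi (M : ℕ) (c : Fin (M + 1) → ℤ) (L : Fin (M + 1) → ℕ) : MvPolynomial (Fin (M + 1)) ℤ →+ ℤ where
  toFun P := (AddMonoidAlgebra.coeff P).sum fun d r => r * E M (shift d L) c
  map_zero' := by simp
  map_add' P Q := by
    rw [AddMonoidAlgebra.coeff_add, Finsupp.sum_add_index']
    · intro d; simp
    · intro d r s; ring

/-- Unfolding `Phi`. -/
theorem Phi_apply (c : Fin (M + 1) → ℤ) (L : Fin (M + 1) → ℕ) (P : MvPolynomial (Fin (M + 1)) ℤ) :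
    Phi M c L P = (AddMonoidAlgebra.coeff P).sum fun d r => r * E M (shift d L) c := rfl

/-- `Phi` on a monomial: `Phi c L (r g^d) = r · E (d − L) c`. -/
theorem Phi_monomial (c : Fin (M + 1) → ℤ) (L : Fin (M + 1) → ℕ) (d : Fin (M + 1) →₀ ℕ) (r : ℤ) :
    Phi M c L (monomial d r) = r * E M (shift d L) c := by
  rw [Phi_apply]
  exact MvPolynomial.sum_monomial_eq (by simp)

/-- The span of the chord `{i, j}` (`i < j`, finite-point indices in a gauge): the sum of the gaps between them,
`spanPoly i j = Σ_{i ≤ t < j} g_t`. -/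
noncomputable def spanPoly (M : ℕ) (i j : ℕ) : MvPolynomial (Fin (M + 1)) ℤ :=
  ∑ t : Fin (M + 1), if i ≤ t.val ∧ t.val < j then X t else 0

/-- The span product of a gauge with `M + 2` finite points `0 < 1 < ⋯ < M+1` (gap `t` between the points `t`, `t+1`)
and chord multiplicities `A i j` (`0 ≤ i < j ≤ M+1`): `∏_{i<j} spanPoly i j ^ A i j`. -/
noncomputable def endProd (M : ℕ) (A : ℕ → ℕ → ℕ) : MvPolynomial (Fin (M + 1)) ℤ :=
  ∏ i ∈ Finset.range (M + 2), ∏ j ∈ Finset.range (M + 2), if i < j then spanPoly M i j ^ A i j else 1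

/-- The monomial exponent vector with entries `B t` on the gaps `t = 0, …, M`. -/
noncomputable def gapVec (M : ℕ) (B : ℕ → ℕ) : Fin (M + 1) →₀ ℕ := Finsupp.equivFunOnFinite.symm fun t => B t.val

/-- The DOWN-SHIFT of an exponent vector: `(aVec d)_t = d_{t+1}` for `t < M` and `(aVec d)_M = 0` — the `g`-exponents of
the image of the neighbouring-gauge monomial `h^d` (`Families/GapGaugeMove`; cf. `E_star`). -/
noncomputable def aVec {M : ℕ} (d : Fin (M + 1) →₀ ℕ) : Fin (M + 1) →₀ ℕ :=
  Finsupp.equivFunOnFinite.symm fun t => if h : t.val + 1 < M + 1 then d ⟨t.val + 1, h⟩ else 0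

/-- `aVec` evaluated below the top index. -/
theorem aVec_apply_castSucc {M : ℕ} (d : Fin (M + 1) →₀ ℕ) (t : Fin M) : aVec d t.castSucc = d t.succ := by
  simp only [aVec, Finsupp.coe_equivFunOnFinite_symm, Fin.val_castSucc]
  rw [dif_pos (by omega)]
  rfl

/-- `aVec` vanishes at the top index `M`. -/
theorem aVec_apply_last {M : ℕ} (d : Fin (M + 1) →₀ ℕ) : aVec d (Fin.last M) = 0 := by
  simp [aVec]

/-- `aVec` is additive. -/
theorem aVec_add {M : ℕ} (d e : Fin (M + 1) →₀ ℕ) : aVec (d + e) = aVec d + aVec e := by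
  ext t
  simp only [aVec, Finsupp.coe_equivFunOnFinite_symm, Finsupp.coe_add, Pi.add_apply]
  split_ifs <;> rfl

end Defs

end GapRegime

end Summit.KontsevichZagierPeriods.Zeta5Search.Families.Cellular
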